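import Summits.Langlands.Langlands.Theses.PerfectLayerClifford

/-!
# Route PerfectLayerClifford — Assembly

The assembly item (stmt-Langlands-27358) of the child route `PerfectLayerClifford` (decomp-langlands lens-4; refining child
`--refines route-Langlands-GaloisHullLift:PerfectHullDescent`, the 93rd cell route) for RPERF = `GaloisHullLift.PerfectHullDescent` (stmt-Langlands-28225):
`PerfectLayerExtension → PerfectLayerRigidity → FiniteTypePerfectDescent → ReduciblePerfectDescent → Summit.Langlands.Langlands.Theses.GaloisHullLift.PerfectHullDescent`.

This is literally the type of the route file's sorry-free deciding theorem `Summit.Langlands.Langlands.Theses.PerfectLayerClifford.closes`.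
Nothing here proves `Langlands` (nor the parent piece): the assembly records only that the items of the route, taken together, imply the parent piece
by name.
-/

set_option linter.dupNamespace false -- project-wide option (lakefile weak.linter.dupNamespace); `Summit.Langlands.Langlands` is the mandated namespace

namespace Summit.Langlands.Langlands.Theorems

/-- **Assembly of route PerfectLayerClifford** (stmt-Langlands-27358):
`PerfectLayerExtension → PerfectLayerRigidity → FiniteTypePerfectDescent → ReduciblePerfectDescent → Summit.Langlands.Langlands.Theses.GaloisHullLift.PerfectHullDescent`.
Proof: unfold `Assembly` and apply the route's deciding theorem `Theses.PerfectLayerClifford.closes`. -/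
theorem perfectLayerClifford_assembly_proof :
    Summit.Langlands.Langlands.Theses.PerfectLayerClifford.Assembly := by
  unfold Summit.Langlands.Langlands.Theses.PerfectLayerClifford.Assembly
  exact Summit.Langlands.Langlands.Theses.PerfectLayerClifford.closes

end Summit.Langlands.Langlands.Theorems
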